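import Mathlib
import Literature.Computability.AlgebraicComplexity.AsymptoticSpectrum
import Literature.Computability.AlgebraicComplexity.BorderRankCW
import Literature.Computability.AlgebraicComplexity.MatrixMultiplicationExponent
import Summits.MatrixMultiplication.MatrixMultiplication.Theses.OutsiderSandwich

/-!
# OutsiderSandwich — the MONOMIAL FLOOR of the little Coppersmith–Winograd tensor
(decomp-mm lens 4 «minimal-counterexample / extremal reduction», gen 6)

ω-free structure theorem.  If the support of a matrix multiplication tensor `⟨k,m,n⟩` embeds
into the support of `cw₂^{⊠N}` along injective index maps (this is what every zeroing-out /
monomial restriction and every combinatorial (M-)degeneration `cw₂^{⊠N} ⊵ ⟨k,m,n⟩` in the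
standard basis provides), then `k·m·n ≤ 2^N`.  Square case: `m³ ≤ 2^N`, i.e. `m² ≤ 4^{N/3}` —
rate `4^{1/3} = 1.5874…` per copy of `cw₂`, attained by the laser blocks (`⟨2,2,2⟩ ≤ cw₂^{⊠3}`,
`I(3,2)` in the lens kernel).  Hence every witness of `CwTwoMMPerfect` (rate `3`) — indeed
everything above rate `1.5874`, e.g. the kernel rung `2.3397` (`CwTwoRateHalfMM`) and `I(2,2)` —
is NON-monomial: it must use identification of variables / signed cancellation (as `HalfMM`
does).

Proof: per coordinate the three letter maps `f_p(κ,ν)`, `g_p(κ,μ)`, `h_p(μ,ν)` satisfy the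
`cw₂`-support constraint at every `(κ,μ,ν)`; a short case analysis (`zeros_absurd`,
`const_of_zeroFree`) shows one of them is constant, whence the letter TRIPLE takes at most two
values on the coordinate; so `(κ,μ,ν) ↦ (p ↦ [triple_p = ℓ₁(p)])` is an injection
`Fin k × Fin m × Fin n ↪ (Fin N → Bool)`.
-/

set_option linter.dupNamespace false -- `MatrixMultiplication.MatrixMultiplication` (summit = problem, D-0017)

namespace Summit.MatrixMultiplication.MatrixMultiplication.Theorems.OutsiderSandwichMonomialFloor

open Literature.Computability.AlgebraicComplexity

/-- The support indicator of `cw₂ = cwTensor K 2` on letters `Fin 3` (Boolean; exactly the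
condition in `cwTensor_apply`). -/
def P (i j k : Fin 3) : Bool :=
  decide ((i = 0 ∧ j = k ∧ j ≠ 0) ∨ (j = 0 ∧ i = k ∧ i ≠ 0) ∨ (k = 0 ∧ i = j ∧ i ≠ 0))

/-- a nonzero entry of `cw₂` lies in the support pattern `P`. [folklore] -/
theorem P_of_cwTensor_ne_zero {K : Type*} [CommSemiring K] (i j k : Fin 3)
    (h : cwTensor K 2 i j k ≠ 0) : P i j k = true := by
  rw [cwTensor_apply] at h
  unfold P
  rw [decide_eq_true_iff]
  by_contra hP
  exact h (if_neg hP)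

/-! ### Local facts about `P` (all by `decide` over `Fin 3`) -/

/-- `P` is symmetric in its first two slots. [folklore] -/
theorem P_swap12 : ∀ i j k : Fin 3, P i j k = true → P j i k = true := by decide
/-- `P` is symmetric in its first and third slots. [folklore] -/
theorem P_swap13 : ∀ i j k : Fin 3, P i j k = true → P k j i = true := by decide
/-- every support triple of `cw₂` has a zero slot. [folklore] -/
theorem P_one_zero : ∀ i j k : Fin 3, P i j k = true → (i = 0 ∨ j = 0 ∨ k = 0) := by decide
/-- support triples with first slot `0` are `(0,v,v)`, `v ≠ 0`. [folklore] -/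
theorem P_first_zero : ∀ i j k : Fin 3, P i j k = true → i = 0 → (j ≠ 0 ∧ k ≠ 0 ∧ j = k) := by
  decide
/-- support triples with second slot `0` are `(v,0,v)`, `v ≠ 0`. [folklore] -/
theorem P_second_zero : ∀ i j k : Fin 3, P i j k = true → j = 0 → (i ≠ 0 ∧ k ≠ 0 ∧ i = k) := by
  decide
/-- support triples with third slot `0` are `(v,v,0)`, `v ≠ 0`. [folklore] -/
theorem P_third_zero : ∀ i j k : Fin 3, P i j k = true → k = 0 → (i ≠ 0 ∧ j ≠ 0 ∧ i = j) := by
  decide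
/-- two nonzero slots `1,2` force the third slot `0` and equality. [folklore] -/
theorem P_two_nonzero_12 : ∀ i j k : Fin 3, P i j k = true → i ≠ 0 → j ≠ 0 → (k = 0 ∧ i = j) := by
  decide
/-- two nonzero slots `1,3` force the second slot `0` and equality. [folklore] -/
theorem P_two_nonzero_13 : ∀ i j k : Fin 3, P i j k = true → i ≠ 0 → k ≠ 0 → (j = 0 ∧ i = k) := by
  decide
/-- two-value conclusions when one slot is constant: third slot `0`. [folklore] -/
theorem P_third_const_zero : ∀ i j : Fin 3, P i j 0 = true →
    ((i, j, (0 : Fin 3)) = (1, 1, 0) ∨ (i, j, (0 : Fin 3)) = (2, 2, 0)) := by decide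
/-- two-value conclusion: third slot a nonzero constant `v`. [folklore] -/
theorem P_third_const_ne : ∀ i j v : Fin 3, P i j v = true → v ≠ 0 →
    ((i, j, v) = (0, v, v) ∨ (i, j, v) = (v, 0, v)) := by decide
/-- two-value conclusion: first slot `0`. [folklore] -/
theorem P_first_const_zero : ∀ j k : Fin 3, P 0 j k = true →
    (((0 : Fin 3), j, k) = (0, 1, 1) ∨ ((0 : Fin 3), j, k) = (0, 2, 2)) := by decide
/-- two-value conclusion: first slot a nonzero constant `v`. [folklore] -/
theorem P_first_const_ne : ∀ v j k : Fin 3, P v j k = true → v ≠ 0 →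
    ((v, j, k) = (v, 0, v) ∨ (v, j, k) = (v, v, 0)) := by decide
/-- two-value conclusion: second slot `0`. [folklore] -/
theorem P_second_const_zero : ∀ i k : Fin 3, P i 0 k = true →
    ((i, (0 : Fin 3), k) = (1, 0, 1) ∨ (i, (0 : Fin 3), k) = (2, 0, 2)) := by decide
/-- two-value conclusion: second slot a nonzero constant `v`. [folklore] -/
theorem P_second_const_ne : ∀ i v k : Fin 3, P i v k = true → v ≠ 0 →
    ((i, v, k) = (0, v, v) ∨ (i, v, k) = (v, v, 0)) := by decide

/-! ### The combinatorial core: one coordinate -/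

section Core

variable {A B C : Type*}

/-  The per-coordinate constraint system is the hypothesis
      `H : ∀ a b c, P (f a c) (g a b) (h b c) = true`
    with `f` on the index pair `(a,c)` (slot 1, `Z_{κν}`), `g` on `(a,b)` (slot 2, `X_{κμ}`),
    `h` on `(b,c)` (slot 3, `Y_{μν}`). -/

/-- Symmetry: let `g` play the role of `f`. -/
theorem sys_swap12 {f : A → C → Fin 3} {g : A → B → Fin 3} {h : B → C → Fin 3}
    (H : ∀ a b c, P (f a c) (g a b) (h b c) = true) :
    ∀ (a : A) (c : C) (b : B), P (g a b) (f a c) (h b c) = true :=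
  fun a c b => P_swap12 _ _ _ (H a b c)

/-- Symmetry: let `h` play the role of `f`. -/
theorem sys_swap13 {f : A → C → Fin 3} {g : A → B → Fin 3} {h : B → C → Fin 3}
    (H : ∀ a b c, P (f a c) (g a b) (h b c) = true) :
    ∀ (b : B) (a : A) (c : C), P (h b c) (g a b) (f a c) = true :=
  fun b a c => P_swap13 _ _ _ (H a b c)

/-- The three letter maps cannot all have a zero. -/
theorem zeros_absurd {f : A → C → Fin 3} {g : A → B → Fin 3} {h : B → C → Fin 3}
    (H : ∀ a b c, P (f a c) (g a b) (h b c) = true)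
    {a₀ : A} {c₀ : C} (hf : f a₀ c₀ = 0) {a₁ : A} {b₁ : B} (hg : g a₁ b₁ = 0)
    {b₂ : B} {c₂ : C} (hh : h b₂ c₂ = 0) : False := by
  have h1 : g a₀ b₁ ≠ 0 := (P_first_zero _ _ _ (H a₀ b₁ c₀) hf).1
  have h2 : h b₁ c₂ ≠ 0 := (P_second_zero _ _ _ (H a₁ b₁ c₂) hg).2.1
  have h3 : f a₀ c₂ ≠ 0 := (P_third_zero _ _ _ (H a₀ b₂ c₂) hh).1
  rcases P_one_zero _ _ _ (H a₀ b₁ c₂) with h0 | h0 | h0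
  · exact h3 h0
  · exact h1 h0
  · exact h2 h0

/-- If `f` is zero-free then one of `f`, `g`, `h` is constant. -/
theorem const_of_zeroFree {f : A → C → Fin 3} {g : A → B → Fin 3} {h : B → C → Fin 3}
    (H : ∀ a b c, P (f a c) (g a b) (h b c) = true) (hf : ∀ a c, f a c ≠ 0) :
    (∃ v, ∀ a c, f a c = v) ∨ (∃ v, ∀ a b, g a b = v) ∨ (∃ v, ∀ b c, h b c = v) := by
  by_cases hg0 : ∀ a b, g a b = 0
  · exact Or.inr (Or.inl ⟨0, hg0⟩)
  push Not at hg0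
  obtain ⟨a₀, b₀, hg⟩ := hg0
  -- row `b₀` of `h` vanishes, and `f a c = g a b₀` for all `a c`
  have hrow : ∀ c, h b₀ c = 0 := fun c => (P_two_nonzero_12 _ _ _ (H a₀ b₀ c) (hf a₀ c) hg).1
  have hfg : ∀ a c, f a c = g a b₀ := fun a c => (P_third_zero _ _ _ (H a b₀ c) (hrow c)).2.2
  by_cases hh0 : ∀ b c, h b c = 0
  · exact Or.inr (Or.inr ⟨0, hh0⟩)
  push Not at hh0
  obtain ⟨b₁, c₁, hh⟩ := hh0
  -- then `f a c₁ = h b₁ c₁` for every `a`, so `f` is constant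
  have hfc : ∀ a, f a c₁ = h b₁ c₁ := fun a =>
    (P_two_nonzero_13 _ _ _ (H a b₁ c₁) (hf a c₁) hh).2
  refine Or.inl ⟨h b₁ c₁, fun a c => ?_⟩
  rw [hfg a c, ← hfg a c₁, hfc a]

/-- One of the three letter maps is constant. -/
theorem one_const {f : A → C → Fin 3} {g : A → B → Fin 3} {h : B → C → Fin 3}
    (H : ∀ a b c, P (f a c) (g a b) (h b c) = true) :
    (∃ v, ∀ a c, f a c = v) ∨ (∃ v, ∀ a b, g a b = v) ∨ (∃ v, ∀ b c, h b c = v) := by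
  by_cases hf : ∀ a c, f a c ≠ 0
  · exact const_of_zeroFree H hf
  by_cases hg : ∀ a b, g a b ≠ 0
  · rcases const_of_zeroFree (A := A) (B := C) (C := B) (f := g) (g := f) (h := fun c b => h b c)
        (sys_swap12 H) hg with ⟨v, hv⟩ | ⟨v, hv⟩ | ⟨v, hv⟩
    · exact Or.inr (Or.inl ⟨v, hv⟩)
    · exact Or.inl ⟨v, hv⟩
    · exact Or.inr (Or.inr ⟨v, fun b c => hv c b⟩)
  by_cases hh : ∀ b c, h b c ≠ 0
  · rcases const_of_zeroFree (A := B) (B := A) (C := C) (f := h) (g := fun b a => g a b) (h := f)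
        (sys_swap13 H) hh with ⟨v, hv⟩ | ⟨v, hv⟩ | ⟨v, hv⟩
    · exact Or.inr (Or.inr ⟨v, hv⟩)
    · exact Or.inr (Or.inl ⟨v, fun a b => hv b a⟩)
    · exact Or.inl ⟨v, hv⟩
  push Not at hf hg hh
  obtain ⟨a₀, c₀, hf⟩ := hf
  obtain ⟨a₁, b₁, hg⟩ := hg
  obtain ⟨b₂, c₂, hh⟩ := hh
  exact (zeros_absurd H hf hg hh).elim

/-- **Core.** On one coordinate the letter triple takes at most two values. -/
theorem two_values {f : A → C → Fin 3} {g : A → B → Fin 3} {h : B → C → Fin 3}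
    (H : ∀ a b c, P (f a c) (g a b) (h b c) = true) :
    ∃ ℓ₁ ℓ₂ : Fin 3 × Fin 3 × Fin 3, ∀ a b c,
      (f a c, g a b, h b c) = ℓ₁ ∨ (f a c, g a b, h b c) = ℓ₂ := by
  rcases one_const H with ⟨v, hv⟩ | ⟨v, hv⟩ | ⟨v, hv⟩
  · -- `f` constant
    by_cases hv0 : v = 0
    · refine ⟨(0, 1, 1), (0, 2, 2), fun a b c => ?_⟩
      have := H a b c
      rw [hv a c, hv0] at this ⊢
      exact P_first_const_zero _ _ this
    · refine ⟨(v, 0, v), (v, v, 0), fun a b c => ?_⟩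
      have := H a b c
      rw [hv a c] at this ⊢
      exact P_first_const_ne _ _ _ this hv0
  · -- `g` constant
    by_cases hv0 : v = 0
    · refine ⟨(1, 0, 1), (2, 0, 2), fun a b c => ?_⟩
      have := H a b c
      rw [hv a b, hv0] at this ⊢
      exact P_second_const_zero _ _ this
    · refine ⟨(0, v, v), (v, v, 0), fun a b c => ?_⟩
      have := H a b c
      rw [hv a b] at this ⊢
      exact P_second_const_ne _ _ _ this hv0
  · -- `h` constant
    by_cases hv0 : v = 0
    · refine ⟨(1, 1, 0), (2, 2, 0), fun a b c => ?_⟩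
      have := H a b c
      rw [hv b c, hv0] at this ⊢
      exact P_third_const_zero _ _ this
    · refine ⟨(0, v, v), (v, 0, v), fun a b c => ?_⟩
      have := H a b c
      rw [hv b c] at this ⊢
      exact P_third_const_ne _ _ _ this hv0

end Core

/-! ### The floor -/

/-- **Monomial floor, rectangular form.** If the support of `⟨k,m,n⟩` embeds into the support of
`cw₂^{⊠N}` along index maps `φ` (forms `Z_{κν}`), `ψ` (variables `X_{κμ}`), `χ` (variables `Y_{μν}`)
with `φ` and `ψ` injective, then `k·m·n ≤ 2^N`. -/
theorem card_le_two_pow_of_supportEmbedding (N k m n : ℕ)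
    (φ : Fin k × Fin n → (Fin N → Fin 3)) (ψ : Fin k × Fin m → (Fin N → Fin 3))
    (χ : Fin m × Fin n → (Fin N → Fin 3))
    (hφ : Function.Injective φ) (hψ : Function.Injective ψ)
    (H : ∀ (κ : Fin k) (μ : Fin m) (ν : Fin n),
      kroneckerPow (cwTensor ℂ 2) N (φ (κ, ν)) (ψ (κ, μ)) (χ (μ, ν)) ≠ 0) :
    k * m * n ≤ 2 ^ N := by
  classical
  -- pointwise support condition
  have Hp : ∀ (p : Fin N) (κ : Fin k) (μ : Fin m) (ν : Fin n),
      P (φ (κ, ν) p) (ψ (κ, μ) p) (χ (μ, ν) p) = true := by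
    intro p κ μ ν
    have h := H κ μ ν
    rw [kroneckerPow_apply, Finset.prod_ne_zero_iff] at h
    exact P_of_cwTensor_ne_zero _ _ _ (h p (Finset.mem_univ p))
  choose ℓ₁ ℓ₂ hℓ using fun p => two_values (f := fun κ ν => φ (κ, ν) p)
    (g := fun κ μ => ψ (κ, μ) p) (h := fun μ ν => χ (μ, ν) p) (Hp p)
  -- the injection into `Fin N → Bool`
  let T : Fin k × Fin m × Fin n → Fin N → Fin 3 × Fin 3 × Fin 3 :=
    fun t p => (φ (t.1, t.2.2) p, ψ (t.1, t.2.1) p, χ (t.2.1, t.2.2) p)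
  let Λ : Fin k × Fin m × Fin n → (Fin N → Bool) := fun t p => decide (T t p = ℓ₁ p)
  have hT : ∀ t p, T t p = ℓ₁ p ∨ T t p = ℓ₂ p := fun t p => hℓ p t.1 t.2.1 t.2.2
  have hΛ : Function.Injective Λ := by
    intro t t' hΛeq
    have htrip : ∀ p, T t p = T t' p := by
      intro p
      have e : (T t p = ℓ₁ p) ↔ (T t' p = ℓ₁ p) := by
        have := congrFun hΛeq p
        simpa [Λ] using this
      rcases hT t p with h1 | h1 <;> rcases hT t' p with h2 | h2
      · exact h1.trans h2.symm
      · exact h1.trans (e.mp h1).symm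
      · exact (e.mpr h2).trans h2.symm
      · exact h1.trans h2.symm
    obtain ⟨κ, μ, ν⟩ := t
    obtain ⟨κ', μ', ν'⟩ := t'
    have hφeq : φ (κ, ν) = φ (κ', ν') := funext fun p => (Prod.mk.inj (htrip p)).1
    have hψeq : ψ (κ, μ) = ψ (κ', μ') := funext fun p => (Prod.mk.inj (Prod.mk.inj (htrip p)).2).1
    have h1 := hφ hφeq
    have h2 := hψ hψeq
    simp only [Prod.mk.injEq] at h1 h2
    obtain ⟨rfl, rfl⟩ := h1
    obtain ⟨-, rfl⟩ := h2
    rfl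
  have hcard := Fintype.card_le_of_injective Λ hΛ
  simp only [Fintype.card_prod, Fintype.card_fin, Fintype.card_fun, Fintype.card_bool] at hcard
  simpa [mul_assoc] using hcard

/-- **Monomial floor, square form** (the route aside `CwTwoMonomialFloor`): a support embedding of
`⟨m,m,m⟩` into `cw₂^{⊠N}` forces `m³ ≤ 2^N`, i.e. `m² ≤ 4^{N/3}`. -/
theorem cube_le_two_pow_of_supportEmbedding (N m : ℕ)
    (φ ψ χ : Fin m × Fin m → (Fin N → Fin 3))
    (hφ : Function.Injective φ) (hψ : Function.Injective ψ) (_hχ : Function.Injective χ)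
    (H : ∀ κ μ ν : Fin m,
      kroneckerPow (cwTensor ℂ 2) N (φ (κ, ν)) (ψ (κ, μ)) (χ (μ, ν)) ≠ 0) :
    m ^ 3 ≤ 2 ^ N := by
  have h := card_le_two_pow_of_supportEmbedding N m m m φ ψ χ hφ hψ H
  simpa [pow_succ, mul_assoc] using h

/-- **Aside `CwTwoMonomialFloor` of route OutsiderSandwich, proved by name** (item
stmt-MatrixMultiplication-29785): injective support embeddings `⟨m,m,m⟩ ↪ supp cw₂^{⊠N}` force
`m³ ≤ 2^N`. [new] -/
theorem cwTwoMonomialFloor_holds :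
    Summit.MatrixMultiplication.MatrixMultiplication.Theses.OutsiderSandwich.CwTwoMonomialFloor :=
  fun N m φ ψ χ hφ hψ hχ H => cube_le_two_pow_of_supportEmbedding N m φ ψ χ hφ hψ hχ H

end Summit.MatrixMultiplication.MatrixMultiplication.Theorems.OutsiderSandwichMonomialFloor
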